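import Literature.NumberTheory.GaloisRepresentations.MinimallyRamified
import Literature.NumberTheory.GaloisRepresentations.FramedRepBaseChange
import Literature.NumberTheory.EllipticCurves.NewformGaloisRep
import Literature.RingTheory.CompleteIntersection.CongruenceModule
import Mathlib.RingTheory.Adjoin.Basic
import Mathlib.Algebra.Algebra.Pi
import Mathlib.Algebra.Algebra.Prod
import HarnessLib

/-!
# The Hecke algebra `T_Σ` of type `Σ` of a modular Galois representation, as a trace algebra
# (Wiles; Darmon–Diamond–Taylor §3.3; Diamond–Ribet §3.1, §4.1; Diamond–Flach–Guo §3.1–3.2)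

Data: a prime `p`, a weight `k`, a commutative ring `O` (intended: the integers of a finite
`K/ℚ_p`) with an algebra map to a local ring `Ō` (intended: `Ō = ℤ̄_p = padicAlgClIntegers p`, the
valuation ring of Mathlib's `ℚ̄_p`; Diamond–Ribet §4.1: "writing `O'_g` for the `O`-subalgebra of
`ℚ̄_ℓ` generated by the Fourier coefficients … we may identify `T_Σ` with the `O`-subalgebra of
`∏_{g ∈ Φ_Σ} O'_g` generated by the operators `T_p`"), a framed `ρ : G_ℚ →ₜ* GL₂(O)` (intended:
a lattice `ρ = ρ_{f,λ}` attached to a newform `f ∈ S_k(Γ₁(N))`, `p ∤ N`, `IsGaloisRepOfNewform1Int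
f ι {r ∣ N p} ρ`, with `ρ̄` absolutely irreducible), and a set of primes `Σ ∌ p`.

* `modularLiftsOfTypeSigma p k Ō ρ Σ` — **the set `N_Σ`** (DFG p. 716: "`N_Σ` = the set of `ρ` in
  `N` such that `Σ_ρ ⊂ Σ`", p. 721: `N` = the `ρ_g` for newforms `g` "of the same weight `k` and
  character `ψ`, but any conductor `N_g` not divisible by `ℓ`" with `a_p(g) ≡ a_p(f) mod λ_g`,
  (73); DDT p. 94: "`N_Σ` = the set of newforms `f` such that `ρ_f` is equivalent to a lifting of
  `ρ̄ ⊗ k_f` of type `Σ`"), realised Galois-theoretically: the framed `ρ' : G_ℚ →ₜ* GL₂(Ō)` which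
  are (i) attached to SOME newform `g ∈ S_k(Γ₁(M))`, `p ∤ M`, along some `j : 𝓞_g →+* Ō`
  (`IsNewform1`, `IsGaloisRepOfNewform1Int` — modularity is quantified, never constructed),
  (ii) congruent to `ρ` (characteristic polynomials coefficientwise `≡ mod 𝔪_Ō`; for `ρ̄`
  absolutely irreducible this is `ρ̄' ≅ ρ̄ ⊗ κ̄`, Brauer–Nesbitt), (iii) of FIXED DETERMINANT
  `det ρ' = det ρ` (DFG p. 715 "`ρ` has determinant `δ`"; DDT §2.7 "`det ρ = ε`"; i.e. same
  nebentypus as a Galois character, same weight), (iv) minimally ramified at every `r ∉ Σ ∪ {p}`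
  (`FramedGaloisRep.IsMinimallyRamifiedAt`, DFG p. 715).  All lattices and frames of each
  `ρ_g ⊗ ℚ̄_p` are members; members with equal traces are not distinguished by `T_Σ`, so this
  redundancy leaves the algebra below unchanged.
* `heckeAlgebraOfTypeSigma p k Ō ρ Σ = T_Σ` — the `O`-subalgebra of `T̃_Σ = O × ∏_{ρ' ∈ N_Σ} Ō`
  generated by the **trace tuples** `T_σ = (tr ρ(σ), (tr ρ'(σ))_{ρ'})` (`traceTuple`) of the good
  Frobenius elements `σ` (`IsGoodFrobenius`: arithmetic Frobenii at primes `r ∉ Σ ∪ {p}` where `ρ`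
  is unramified) — DDT p. 94: "Set `T̃_Σ = ∏_{f ∈ N_Σ} O_f'`. If `p` is a prime not in `Σ` and not
  dividing `ℓ N(ρ̄)`, we let `T_p` denote the element `(a_p(f))_f` in `T̃_Σ`. Then define `T_Σ` to
  be the `O`-subalgebra of `T̃_Σ` generated by the elements `T_p` for such primes `p`"; DFG p. 718:
  `K̄ ⊗ T_Σ ≅ ∏_{N_Σ} K̄`, `t_g ↦ (tr ρ(g))_ρ`.  For members unramified at `r` (all of them when
  `ρ̄` is absolutely irreducible: `ρ̄` is unramified at `r`, and minimal ramification then forces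
  `ρ'(I_r) = 1`, `IsMinimallyRamifiedAt.isUnramifiedAt_of_reduction_eq_one`) the
  `ρ'`-coordinate of `T_σ` is `tr ρ'(Frob_r) = j(a_r(g))` for ANY Frobenius `σ` at `r`, so `T_σ`
  is the `T_r` of the sources; all Frobenii at all good `r` are adjoined, no choice is made.
  The extra first coordinate is `f` itself with values in `O` (DDT p. 96: "`f ∈ N_Σ` whose
  Fourier coefficients are in `O` … projection to the component corresponding to `f` gives
  `π = π_f : T_Σ → O`"); it duplicates the coordinate of the member `ρ ⊗_O Ō ∈ N_Σ`
  (`baseChange_mem_modularLiftsOfTypeSigma`, `algebraMap_augmentation_eq_baseChange`), hence does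
  not change `T_Σ`, and makes the augmentation an honest `O`-algebra map:
* `heckeAlgebraOfTypeSigma.augmentation = π_f = λ_f : T_Σ →ₐ[O] O` (surjective), and
  `sigmaCongruenceIdeal p k Ō ρ Σ = η_Σ = π_f(Ann_{T_Σ}(ker π_f))` (DDT (3.3.1); Diamond–Ribet §4.1;
  the tree's `congruenceIdeal`), the right-hand side of the numerical criterion for `R_Σ ↠ T_Σ`.
* Proved API: `modularLiftsOfTypeSigma_mono`, `traceTuple_mem`, `augmentation_traceTuple`,
  `augmentation_surjective`, `algebraMap_augmentation_eq`, `isReduced` (DDT p. 94 "it is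
  reduced"), the change-of-`Σ` map `restrict : T_Σ' →ₐ[O] T_Σ` for `Σ ⊆ Σ'` with
  `augmentation_comp_restrict` (DDT Lemma 3.27 (b)), `IsGaloisRepOfNewform1Int.baseChange`.

NOT HERE (cited only; none is needed to STATE the numerical criterion at `(T_Σ, π_f)`): `T_Σ` is
complete local, finite and free over `O` (DDT p. 94; DFG (72); finiteness of `N_Σ` rests on
Carayol–Livné); surjectivity of `restrict` (DDT Lemma 3.27 (b); Chebotarev: `T_Σ` is topologically
generated by the traces of any cofinite set of Frobenii); `ρ^mod_Σ : G_ℚ → GL₂(T_Σ)`; `R_Σ ↠ T_Σ`;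
`T_Σ ≅ T_𝔪` at level `N_Σ = N(ρ̄) ∏ q^{m_q}` in weight `2` (DDT Prop. 4.7; Diamond–Ribet Lemma 3.2);
the relation with `FullHeckeAlgebra`/`newformCongruenceIdeal` of `HeckeCongruenceIdeal.lean`
(level `Γ₁(N)`, nebentypus free — `ad ρ` rather than `ad⁰ ρ`).

Design: inputs are `(p, k, Ō, ρ, Σ)` — `T_Σ` depends on `f` only through the traces, determinant
and reduction of `ρ = ρ_{f,ι}`; generators sit at the primes `r ∉ Σ ∪ {p}` where `ρ` is UNRAMIFIED
(DDT: `r ∤ ℓ N(ρ̄)`; the same primes when `ρ` is minimally ramified outside `Σ`, and adjoining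
finitely many Frobenius classes more or less does not change the closed trace algebra).  `Ō` too
small (e.g. `Ō = O`) makes `N_Σ(Ō)` see only forms with coefficients in `Ō` (DDT Lemma 3.27 (c)).
Mathlib/tree search: no `T_Σ`/`typeSigma`/`minimally ramified` anywhere; `congruenceIdeal`,
`FullHeckeAlgebra`, `IsGaloisRepOfNewform1Int`, `FramedRep.baseChange` are reused.

## References

* H. Darmon, F. Diamond, R. Taylor, *Fermat's Last Theorem*, CDM 1995: §2.7 (p. 76), §3.3
  (pp. 94–97: `N_Σ`, `T̃_Σ`, `T_Σ`, Lemma 3.27, Remark 3.33, (3.3.1)), Prop. 4.7. [DarmonDiamondTaylor1995]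
* F. Diamond, M. Flach, L. Guo, Ann. Sci. ÉNS 37 (2004): §3.1 (pp. 715–718), §3.2 (p. 721, (73)),
  Thm. 3.7. [DiamondFlachGuo2004]
* F. Diamond, K. Ribet, in Cornell–Silverman–Stevens (1997): §3.1, Lemma 3.2, §4.1. [DiamondRibet1997]
* A. Wiles, Ann. of Math. 141 (1995), Ch. 2 §3. [Wiles1995Annals]
-/

noncomputable section

open scoped NumberField MatrixGroups ModularForm

open Field IsDedekindDomain IsLocalRing CongruenceSubgroup Rat.HeightOneSpectrum

namespace Literature.NumberTheory.Automorphic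

open Literature.NumberTheory.GaloisRepresentations
open Literature.NumberTheory.EllipticCurves.ModularForms
open Literature.RingTheory.CompleteIntersection

universe u v

variable (p : ℕ) (k : ℤ) {O : Type u} [CommRing O] [TopologicalSpace O]
  (Ō : Type v) [CommRing Ō] [IsLocalRing Ō] [TopologicalSpace Ō] [Algebra O Ō]
  (ρ : FramedGaloisRep ℚ O 2) (S : Set ℕ)

/-! ### The set `N_Σ` of modular lifts of type `Σ` -/

/-- **The set `N_Σ = N_Σ(Ō)` of modular lifts of type `Σ`** of `ρ : G_ℚ →ₜ* GL₂(O)` with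
coefficients in the local `O`-algebra `Ō` (intended `ℤ̄_p`): the framed `ρ' : G_ℚ →ₜ* GL₂(Ō)`
(i) attached along some `j : 𝓞_g →+* Ō` to some newform `g ∈ S_k(Γ₁(M))` of the same weight
and some level `M`, `p ∤ M` (`IsGaloisRepOfNewform1Int g j {r ∣ M p} ρ'`: unramified outside
`M p`, `charpoly ρ'(Frob_r) = j(X² − a_r(g) X + ε_g(r) r^{k−1})`); (ii) `ρ' ≡ ρ mod 𝔪_Ō`
(characteristic polynomials coefficientwise congruent); (iii) `det ρ'(σ) = det ρ(σ)` for all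
`σ` (fixed determinant); (iv) minimally ramified (`FramedGaloisRep.IsMinimallyRamifiedAt`) at
every place `v` of `ℚ` with prime `r = primesEquiv v ∉ Σ`, `r ≠ p`.  (DFG p. 716 "`N_Σ`" with
p. 721 "`N`"; DDT p. 94 "`N_Σ`"; quotations in the module docstring.)
[cite: DiamondFlachGuo2004, §3.1 p. 716 and §3.2 p. 721] -/
def modularLiftsOfTypeSigma : Set (FramedGaloisRep ℚ Ō 2) :=
  {ρ' | (∃ (M : ℕ) (_ : NeZero M) (g : CuspForm (Gamma1 M) k) (j : coeffCharIntegers g →+* Ō),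
          IsNewform1 g ∧ ¬ p ∣ M ∧ IsGaloisRepOfNewform1Int g j {r | r ∣ M * p} ρ') ∧
      (∀ (σ : absoluteGaloisGroup ℚ) (i : ℕ),
          (FramedRep.charpoly ρ' σ).coeff i - algebraMap O Ō ((FramedRep.charpoly ρ σ).coeff i) ∈
            maximalIdeal Ō) ∧
      (∀ σ : absoluteGaloisGroup ℚ,
          ((ρ' σ : GL (Fin 2) Ō) : Matrix (Fin 2) (Fin 2) Ō).det =
            algebraMap O Ō ((ρ σ : GL (Fin 2) O) : Matrix (Fin 2) (Fin 2) O).det) ∧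
      ∀ v : HeightOneSpectrum (𝓞 ℚ), ((primesEquiv v : Nat.Primes) : ℕ) ∉ S →
        ((primesEquiv v : Nat.Primes) : ℕ) ≠ p → ρ'.IsMinimallyRamifiedAt v}

variable {p k Ō ρ S} in
/-- Membership in `N_Σ`, unfolded. [folklore] -/
theorem mem_modularLiftsOfTypeSigma_iff {ρ' : FramedGaloisRep ℚ Ō 2} :
    ρ' ∈ modularLiftsOfTypeSigma p k Ō ρ S ↔
      (∃ (M : ℕ) (_ : NeZero M) (g : CuspForm (Gamma1 M) k) (j : coeffCharIntegers g →+* Ō),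
          IsNewform1 g ∧ ¬ p ∣ M ∧ IsGaloisRepOfNewform1Int g j {r | r ∣ M * p} ρ') ∧
        (∀ (σ : absoluteGaloisGroup ℚ) (i : ℕ),
            (FramedRep.charpoly ρ' σ).coeff i -
                algebraMap O Ō ((FramedRep.charpoly ρ σ).coeff i) ∈ maximalIdeal Ō) ∧
        (∀ σ : absoluteGaloisGroup ℚ,
            ((ρ' σ : GL (Fin 2) Ō) : Matrix (Fin 2) (Fin 2) Ō).det =
              algebraMap O Ō ((ρ σ : GL (Fin 2) O) : Matrix (Fin 2) (Fin 2) O).det) ∧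
        ∀ v : HeightOneSpectrum (𝓞 ℚ), ((primesEquiv v : Nat.Primes) : ℕ) ∉ S →
          ((primesEquiv v : Nat.Primes) : ℕ) ≠ p → ρ'.IsMinimallyRamifiedAt v :=
  Iff.rfl

variable {p k Ō ρ} in
/-- `N_Σ` grows with `Σ` (DFG p. 716: `N_Σ = {ρ ∈ N : Σ_ρ ⊆ Σ}`; DDT §2.7: "if `Σ ⊂ Σ'` and `ρ` is
a lifting of type `Σ` then it is also a lifting of type `Σ'`"). [cite: DarmonDiamondTaylor1995, §2.7, p. 76] -/
theorem modularLiftsOfTypeSigma_mono {S S' : Set ℕ} (h : S ⊆ S') :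
    modularLiftsOfTypeSigma p k Ō ρ S ⊆ modularLiftsOfTypeSigma p k Ō ρ S' := by
  rintro ρ' ⟨hmod, hcong, hdet, hmin⟩
  exact ⟨hmod, hcong, hdet, fun v hv hvp => hmin v (fun hS => hv (h hS)) hvp⟩

/-! ### Trace tuples and the Hecke algebra `T_Σ` -/

/-- The **trace tuple** `T_σ = (tr ρ(σ), (tr ρ'(σ))_{ρ' ∈ N_Σ}) ∈ T̃_Σ = O × ∏_{N_Σ} Ō` of
`σ ∈ G_ℚ`; for `σ = Frob_r`, `r ∉ Σ ∪ {p}` unramified, this is the tuple `T_r = (a_r(g))_g` of DDT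
§3.3 / Diamond–Ribet §3.1 (first coordinate: `f` itself). [cite: DarmonDiamondTaylor1995, §3.3, p. 94] -/
def traceTuple (σ : absoluteGaloisGroup ℚ) : O × (modularLiftsOfTypeSigma p k Ō ρ S → Ō) :=
  (FramedRep.trace ρ σ, fun ρ' => FramedRep.trace (ρ' : FramedGaloisRep ℚ Ō 2) σ)

/-- Unfolding lemma: first coordinate of a trace tuple. [folklore] -/
@[simp] theorem traceTuple_fst (σ : absoluteGaloisGroup ℚ) :
    (traceTuple p k Ō ρ S σ).1 = FramedRep.trace ρ σ :=
  rfl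

/-- Unfolding lemma: the `ρ'`-coordinate of a trace tuple. [folklore] -/
@[simp] theorem traceTuple_snd_apply (σ : absoluteGaloisGroup ℚ)
    (ρ' : modularLiftsOfTypeSigma p k Ō ρ S) :
    (traceTuple p k Ō ρ S σ).2 ρ' = FramedRep.trace (ρ' : FramedGaloisRep ℚ Ō 2) σ :=
  rfl

/-- **Good Frobenius elements for `(ρ, Σ, p)`**: `σ ∈ G_ℚ` is an arithmetic Frobenius (Mathlib
`IsArithFrobAt`) at some prime `𝔓` of `\bar ℤ` over a place `v` of `ℚ` whose prime `r` satisfies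
`r ∉ Σ`, `r ≠ p`, `ρ` unramified at `r` — the primes indexing the generators `T_r` of `T_Σ` (DDT
§3.3: "`p` a prime not in `Σ` and not dividing `ℓ N(ρ̄)`"; "`ρ` unramified at `r`" replaces
"`r ∤ N(ρ̄)`", the same primes for `ρ` minimally ramified outside `Σ`). [cite: DarmonDiamondTaylor1995, §3.3, p. 94] -/
def IsGoodFrobenius (σ : absoluteGaloisGroup ℚ) : Prop :=
  ∃ (v : HeightOneSpectrum (𝓞 ℚ)) (𝔓 : Ideal (absIntegers (𝓞 ℚ) ℚ)),
    ((primesEquiv v : Nat.Primes) : ℕ) ∉ S ∧ ((primesEquiv v : Nat.Primes) : ℕ) ≠ p ∧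
      ρ.IsUnramifiedAt v ∧ 𝔓 ∈ v.primesAbove ∧ IsArithFrobAt (𝓞 ℚ) σ 𝔓

variable {p ρ} in
/-- Good Frobenius elements for `Σ'` are good for every `Σ ⊆ Σ'`. [folklore] -/
theorem IsGoodFrobenius.mono {S S' : Set ℕ} (h : S ⊆ S') {σ : absoluteGaloisGroup ℚ}
    (hσ : IsGoodFrobenius p ρ S' σ) : IsGoodFrobenius p ρ S σ := by
  obtain ⟨v, 𝔓, hv, hvp, hur, h𝔓, hfrob⟩ := hσ
  exact ⟨v, 𝔓, fun hS => hv (h hS), hvp, hur, h𝔓, hfrob⟩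

/-- **The Hecke algebra `T_Σ` of type `Σ`** (Wiles; Darmon–Diamond–Taylor §3.3, p. 94;
Diamond–Ribet §3.1, §4.1; Diamond–Flach–Guo §3.1, p. 718): the `O`-subalgebra of
`T̃_Σ = O × ∏_{ρ' ∈ N_Σ} Ō` generated by the trace tuples `T_σ = (tr ρ(σ), (tr ρ'(σ))_{ρ'})` of
all good Frobenius elements `σ` (`IsGoodFrobenius`: arithmetic Frobenii at primes
`r ∉ Σ ∪ {p}` where `ρ` is unramified), i.e. by the tuples `T_r = (a_r(g))_{g ∈ N_Σ}` of the
sources ("define `T_Σ` to be the `O`-subalgebra of `T̃_Σ` generated by the elements `T_p` for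
such primes `p`", DDT p. 94).  A commutative `O`-algebra; reduced when `O, Ō` are
(`isReduced`); complete local, finite and free over `O` by DDT §3.3 / DFG (72) (not proved
here). [cite: DarmonDiamondTaylor1995, §3.3, p. 94] -/
def heckeAlgebraOfTypeSigma : Subalgebra O (O × (modularLiftsOfTypeSigma p k Ō ρ S → Ō)) :=
  Algebra.adjoin O (traceTuple p k Ō ρ S '' {σ | IsGoodFrobenius p ρ S σ})

variable {p k Ō ρ S} in
/-- The generators `T_σ`, `σ` a good Frobenius, lie in `T_Σ`. [folklore] -/
theorem traceTuple_mem {σ : absoluteGaloisGroup ℚ} (hσ : IsGoodFrobenius p ρ S σ) :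
    traceTuple p k Ō ρ S σ ∈ heckeAlgebraOfTypeSigma p k Ō ρ S :=
  Algebra.subset_adjoin ⟨σ, hσ, rfl⟩

/-! ### The augmentation `π_f : T_Σ → O` and the congruence ideal `η_Σ` -/

namespace heckeAlgebraOfTypeSigma

/-- **The augmentation `λ_f = π_f : T_Σ →ₐ[O] O`**, projection to the `f`-coordinate (DDT §3.3,
p. 96: "projection to the component corresponding to `f` gives rise to an `O`-algebra
homomorphism `π = π_f : T_Σ → O`"; Diamond–Ribet §4.1: `π_Σ : T_Σ → O`; DFG: `θ`), i.e. the
restriction to `T_Σ` of the first projection `T̃_Σ = O × ∏ Ō → O`.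
[cite: DarmonDiamondTaylor1995, §3.3, p. 96] -/
def augmentation : heckeAlgebraOfTypeSigma p k Ō ρ S →ₐ[O] O :=
  (AlgHom.fst O O (modularLiftsOfTypeSigma p k Ō ρ S → Ō)).comp
    (heckeAlgebraOfTypeSigma p k Ō ρ S).val

/-- `π_f x` is the first coordinate of `x ∈ T_Σ ⊆ O × ∏ Ō`. [folklore] -/
@[simp] theorem augmentation_apply (x : heckeAlgebraOfTypeSigma p k Ō ρ S) :
    augmentation p k Ō ρ S x = (x : O × (modularLiftsOfTypeSigma p k Ō ρ S → Ō)).1 :=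
  rfl

variable {p k Ō ρ S} in
/-- `π_f(T_σ) = tr ρ(σ)` (`= ι(a_r(f))` for `σ = Frob_r`: DDT Remark 3.33, "the homomorphism is
defined by `T_p ↦ a_p(f)`"). [cite: DarmonDiamondTaylor1995, §3.3, Remark 3.33 (p. 96)] -/
theorem augmentation_traceTuple {σ : absoluteGaloisGroup ℚ} (hσ : IsGoodFrobenius p ρ S σ) :
    augmentation p k Ō ρ S ⟨traceTuple p k Ō ρ S σ, traceTuple_mem hσ⟩ = FramedRep.trace ρ σ :=
  rfl

/-- `π_f` is surjective (it is an `O`-algebra map to `O`). [folklore] -/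
theorem augmentation_surjective : Function.Surjective (augmentation p k Ō ρ S) :=
  Literature.RingTheory.CompleteIntersection.augmentation_surjective
    (T := heckeAlgebraOfTypeSigma p k Ō ρ S) (augmentation p k Ō ρ S)

variable {p k Ō ρ S} in
/-- **The `f`-coordinate is redundant.** If `ρ₁ ∈ N_Σ` has the traces of `ρ` (e.g.
`ρ₁ = ρ ⊗_O Ō`, `baseChange_mem_modularLiftsOfTypeSigma`), then for `x ∈ T_Σ` the image in `Ō`
of `π_f(x)` is the `ρ₁`-coordinate of `x`; so for injective `O → Ō`, `T_Σ` projects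
isomorphically onto its image in `∏_{N_Σ} Ō`, the algebra of the sources. [folklore] -/
theorem algebraMap_augmentation_eq (ρ₁ : modularLiftsOfTypeSigma p k Ō ρ S)
    (hρ₁ : ∀ σ : absoluteGaloisGroup ℚ,
      FramedRep.trace (ρ₁ : FramedGaloisRep ℚ Ō 2) σ = algebraMap O Ō (FramedRep.trace ρ σ))
    (x : heckeAlgebraOfTypeSigma p k Ō ρ S) :
    algebraMap O Ō (augmentation p k Ō ρ S x) =
      (x : O × (modularLiftsOfTypeSigma p k Ō ρ S → Ō)).2 ρ₁ := by
  obtain ⟨x, hx⟩ := x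
  rw [augmentation_apply]
  change algebraMap O Ō x.1 = x.2 ρ₁
  induction hx using Algebra.adjoin_induction with
  | mem y hy =>
    obtain ⟨σ, -, rfl⟩ := hy
    rw [traceTuple_fst, traceTuple_snd_apply, hρ₁]
  | algebraMap r => rfl
  | add y z _ _ hy hz => rw [Prod.fst_add, Prod.snd_add, Pi.add_apply, map_add, hy, hz]
  | mul y z _ _ hy hz => rw [Prod.fst_mul, Prod.snd_mul, Pi.mul_apply, map_mul, hy, hz]

/-- `T_Σ` is reduced as soon as `O` and `Ō` are (e.g. domains): it is a subring of
`O × ∏ Ō` (DDT §3.3, p. 94: "Moreover it is reduced"; DFG (72)). [cite: DarmonDiamondTaylor1995, §3.3, p. 94] -/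
theorem isReduced [IsReduced O] [IsReduced Ō] : IsReduced (heckeAlgebraOfTypeSigma p k Ō ρ S) := by
  refine ⟨fun x hx => ?_⟩
  obtain ⟨m, hm⟩ := hx
  have hm' : ((x : O × (modularLiftsOfTypeSigma p k Ō ρ S → Ō))) ^ m = 0 := by
    rw [← SubmonoidClass.coe_pow, hm]; rfl
  refine Subtype.ext (Prod.ext ?_ (funext fun ρ' => ?_))
  · exact IsReduced.eq_zero _ ⟨m, by rw [← Prod.pow_fst, hm']; rfl⟩
  · exact IsReduced.eq_zero _ ⟨m, by rw [← Pi.pow_apply, ← Prod.pow_snd, hm']; rfl⟩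

/-! ### Change of `Σ` -/

variable {S}

/-- The restriction map `T̃_Σ' → T̃_Σ` for `Σ ⊆ Σ'`: identity on the `O`-coordinate, restriction
of functions along `N_Σ ⊆ N_Σ'` (`modularLiftsOfTypeSigma_mono`). [folklore] -/
def restrictAmbient {S' : Set ℕ} (h : S ⊆ S') :
    (O × (modularLiftsOfTypeSigma p k Ō ρ S' → Ō)) →ₐ[O]
      (O × (modularLiftsOfTypeSigma p k Ō ρ S → Ō)) :=
  (AlgHom.fst O O _).prod
    ((AlgHom.pi fun ρ' : modularLiftsOfTypeSigma p k Ō ρ S =>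
        Pi.evalAlgHom O (fun _ : modularLiftsOfTypeSigma p k Ō ρ S' => Ō)
          ⟨ρ'.1, modularLiftsOfTypeSigma_mono h ρ'.2⟩).comp
      (AlgHom.snd O O _))

/-- `restrictAmbient` sends the trace tuple of `σ` for `Σ'` to the trace tuple of `σ` for `Σ`.
[folklore] -/
@[simp] theorem restrictAmbient_traceTuple {S' : Set ℕ} (h : S ⊆ S') (σ : absoluteGaloisGroup ℚ) :
    restrictAmbient p k Ō ρ h (traceTuple p k Ō ρ S' σ) = traceTuple p k Ō ρ S σ :=
  rfl

/-- **Change of `Σ`** (DDT Lemma 3.27 (b): "If `Σ' ⊃ Σ` then there is a unique surjection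
`T_Σ' ↠ T_Σ` such that … `T_p` maps to `T_p`"; DFG p. 717): for `Σ ⊆ Σ'` the restriction
`T̃_Σ' → T̃_Σ` maps `T_Σ'` into `T_Σ` (generators to generators, `IsGoodFrobenius.mono`), giving
an `O`-algebra map `T_Σ' →ₐ[O] T_Σ` compatible with the augmentations
(`augmentation_comp_restrict`).  Its surjectivity (loc. cit.) is not proved here.
[cite: DarmonDiamondTaylor1995, §3.3, Lemma 3.27 (b) (p. 94)] -/
def restrict {S' : Set ℕ} (h : S ⊆ S') :
    heckeAlgebraOfTypeSigma p k Ō ρ S' →ₐ[O] heckeAlgebraOfTypeSigma p k Ō ρ S :=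
  ((restrictAmbient p k Ō ρ h).comp (heckeAlgebraOfTypeSigma p k Ō ρ S').val).codRestrict
    (heckeAlgebraOfTypeSigma p k Ō ρ S) fun x => by
      have hle : heckeAlgebraOfTypeSigma p k Ō ρ S' ≤
          (heckeAlgebraOfTypeSigma p k Ō ρ S).comap (restrictAmbient p k Ō ρ h) := by
        refine Algebra.adjoin_le ?_
        rintro _ ⟨σ, hσ, rfl⟩
        rw [SetLike.mem_coe, Subalgebra.mem_comap, restrictAmbient_traceTuple]
        exact traceTuple_mem (hσ.mono h)
      exact (Subalgebra.mem_comap _ _ _).mp (hle x.2)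

/-- The change-of-`Σ` maps are compatible with the augmentations: `π_f ∘ (T_Σ' → T_Σ) = π_f`
(DDT §3.3, p. 97: "`π_Σ'` denote the composite `T_Σ' → T_Σ → O`"). [cite: DarmonDiamondTaylor1995, §3.3, p. 97] -/
theorem augmentation_comp_restrict {S' : Set ℕ} (h : S ⊆ S') :
    (augmentation p k Ō ρ S).comp (restrict p k Ō ρ h) = augmentation p k Ō ρ S' :=
  AlgHom.ext fun _ => rfl

end heckeAlgebraOfTypeSigma

/-! ### The base change `ρ ⊗_O Ō` is a member of `N_Σ` -/

section BaseChange

variable {p k Ō ρ S}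

/-- "`ρ` is attached to `f` away from `T`" is stable under any continuous change of coefficients
`g : A →+* B`: `ρ ⊗_g B` is attached to `f` along `g ∘ ι` (unramifiedness and Frobenius
characteristic polynomials are transported, `FramedGaloisRep.hasFrobCharpolyAt_baseChange`).
Declared by its absolute name as a dot-notation extension of `IsGaloisRepOfNewform1Int`
(`NewformGaloisRep.lean`). (Deligne–Serre 1974, §6: the `λ`-adic and mod-`λ` incarnations.) [folklore] -/
theorem _root_.Literature.NumberTheory.EllipticCurves.ModularForms.IsGaloisRepOfNewform1Int.baseChange
    {N : ℕ} [NeZero N] {f : CuspForm (Gamma1 N) k} {A : Type*} [CommRing A] [TopologicalSpace A]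
    {B : Type*} [CommRing B] [TopologicalSpace B] {ι : coeffCharIntegers f →+* A} {T : Set ℕ}
    {ρ₀ : FramedGaloisRep ℚ A 2} (h : IsGaloisRepOfNewform1Int f ι T ρ₀) (g : A →+* B)
    (hg : Continuous g) :
    IsGaloisRepOfNewform1Int f (g.comp ι) T (FramedRep.baseChange g hg ρ₀) := by
  intro v hv
  obtain ⟨hur, P, hP, hchar⟩ := h v hv
  refine ⟨fun 𝔓 h𝔓 σ hσ => ?_, P, hP, ?_⟩
  · rw [FramedRep.baseChange_apply, hur 𝔓 h𝔓 σ hσ, map_one]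
  · rw [← Polynomial.map_map]
    exact FramedGaloisRep.hasFrobCharpolyAt_baseChange g hg hchar

/-- Traces commute with change of coefficients: `tr (ρ ⊗_g B)(σ) = g(tr ρ(σ))`
(Mathlib `AddMonoidHom.map_trace`).  Declared by its absolute name as a dot-notation extension of
`FramedRep` (`ContinuousRep.lean`). [folklore] -/
theorem _root_.Literature.NumberTheory.GaloisRepresentations.FramedRep.trace_baseChange
    {G : Type*} [Group G] [TopologicalSpace G] {A : Type*} [CommRing A] [TopologicalSpace A]
    {B : Type*} [CommRing B] [TopologicalSpace B] {n : ℕ} (g : A →+* B) (hg : Continuous g)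
    (ρ₀ : FramedRep G A n) (σ : G) :
    FramedRep.trace (FramedRep.baseChange g hg ρ₀) σ = g (FramedRep.trace ρ₀ σ) := by
  unfold FramedRep.trace
  rw [FramedRep.coe_baseChange_apply, AddMonoidHom.map_trace]

/-- **`ρ ⊗_O Ō ∈ N_Σ` in the intended regime.** If `ρ : G_ℚ →ₜ* GL₂(O)` is attached to a newform
`f ∈ S_k(Γ₁(N))`, `p ∤ N`, away from `{r ∣ N p}` along `ι : 𝓞_f → O`, the structure map `O → Ō`
is continuous, and the base change `ρ ⊗_O Ō` is minimally ramified at every `r ∉ Σ ∪ {p}`, then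
`ρ ⊗_O Ō` lies in `N_Σ(Ō)` (congruent to itself, same determinant): `f ∈ N_Σ` (DDT §3.3, p. 96;
Diamond–Ribet §4.1: "`f` in `Φ_∅`, hence in `Φ_Σ` for every `Σ`"). [cite: DarmonDiamondTaylor1995, §3.3, p. 96] -/
theorem baseChange_mem_modularLiftsOfTypeSigma {N : ℕ} [NeZero N] {f : CuspForm (Gamma1 N) k}
    {ι : coeffCharIntegers f →+* O} (hc : Continuous (algebraMap O Ō)) (hf : IsNewform1 f)
    (hpN : ¬ p ∣ N) (hρ : IsGaloisRepOfNewform1Int f ι {r | r ∣ N * p} ρ)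
    (hmin : ∀ v : HeightOneSpectrum (𝓞 ℚ), ((primesEquiv v : Nat.Primes) : ℕ) ∉ S →
      ((primesEquiv v : Nat.Primes) : ℕ) ≠ p →
        FramedGaloisRep.IsMinimallyRamifiedAt v (FramedRep.baseChange (algebraMap O Ō) hc ρ)) :
    FramedRep.baseChange (algebraMap O Ō) hc ρ ∈ modularLiftsOfTypeSigma p k Ō ρ S := by
  refine ⟨⟨N, inferInstance, f, (algebraMap O Ō).comp ι, hf, hpN, hρ.baseChange _ hc⟩,
    fun σ i => ?_, fun σ => ?_, hmin⟩
  · rw [FramedRep.charpoly_baseChange, Polynomial.coeff_map, sub_self]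
    exact Ideal.zero_mem _
  · rw [FramedRep.coe_baseChange_apply, ← RingHom.mapMatrix_apply, ← RingHom.map_det]

/-- For `x ∈ T_Σ`, the image in `Ō` of the `f`-coordinate `π_f(x)` is the coordinate of `x` at
the member `ρ ⊗_O Ō ∈ N_Σ`: the extra `O`-coordinate duplicates an honest coordinate of the
product `∏_{N_Σ} Ō` of the sources. [folklore] -/
theorem algebraMap_augmentation_eq_baseChange (hc : Continuous (algebraMap O Ō))
    (hmem : FramedRep.baseChange (algebraMap O Ō) hc ρ ∈ modularLiftsOfTypeSigma p k Ō ρ S)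
    (x : heckeAlgebraOfTypeSigma p k Ō ρ S) :
    algebraMap O Ō (heckeAlgebraOfTypeSigma.augmentation p k Ō ρ S x) =
      (x : O × (modularLiftsOfTypeSigma p k Ō ρ S → Ō)).2 ⟨_, hmem⟩ :=
  heckeAlgebraOfTypeSigma.algebraMap_augmentation_eq ⟨_, hmem⟩
    (fun σ => FramedRep.trace_baseChange (algebraMap O Ō) hc ρ σ) x

end BaseChange

/-- **The congruence ideal `η_Σ = η_Σ(f) ⊆ O` of type `Σ`**: the congruence ideal
`π_f(Ann_{T_Σ}(ker π_f))` (tree: `Literature.RingTheory.CompleteIntersection.congruenceIdeal`) of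
the augmentation `π_f : T_Σ → O` (DDT (3.3.1), p. 97: "`η_Σ' = π_Σ'(Ann_{T_Σ'}(ker π_Σ'))`";
Diamond–Ribet §4.1; `length_O(O/η_Σ)` is the right-hand side of Criterion I of
de Smit–Rubin–Schoof for `R_Σ ↠ T_Σ`). [cite: DarmonDiamondTaylor1995, (3.3.1), p. 97] -/
def sigmaCongruenceIdeal : Ideal O :=
  congruenceIdeal (T := heckeAlgebraOfTypeSigma p k Ō ρ S)
    (heckeAlgebraOfTypeSigma.augmentation p k Ō ρ S)

/-- `x ∈ η_Σ` iff `x = π_f(t)` for some `t ∈ T_Σ` annihilating `ker π_f`. [folklore] -/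
theorem mem_sigmaCongruenceIdeal_iff {x : O} :
    x ∈ sigmaCongruenceIdeal p k Ō ρ S ↔
      ∃ t ∈ (RingHom.ker (heckeAlgebraOfTypeSigma.augmentation p k Ō ρ S)).annihilator,
        heckeAlgebraOfTypeSigma.augmentation p k Ō ρ S t = x :=
  mem_congruenceIdeal_iff (T := heckeAlgebraOfTypeSigma p k Ō ρ S) _

end Literature.NumberTheory.Automorphic
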